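import Summits.Ventures.YMGap.RobustBall.HeatBathPoincareZd
import Summits.Ventures.YMGap.RobustBall.RobustMassGapDoorKR
import HarnessLib

/-!
# Robust ball (Y2) — THE HEAT-BATH POINCARÉ INEQUALITY OF A FINITE VOLUME OF `ℤ^d` WITH BOUNDARY CONDITION, UNIFORMLY IN THE VOLUME, THE BOUNDARY
# FIELD AND THE MEMBER OF THE `ℤ^d` BALL

HONEST FRAMING: venture file of the cell `pub-ymgap` (QuantumFields programme), track ROBUST-BALL, seat rb-p2 (g13); the BALL-UNIFORM version of g12's
`HeatBathPoincareZd.kernelVariance_le_of_oneLinkKRModulus` (Wilson).  LATTICE statements at STRONG COUPLING for the perturbed specifications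
`γ^W_V(·|η) = perturbedYM χ_N (Nβ) W supp V η` ('t Hooft `β`) of the MEMBERS of rb-p1's `ℤ^d` ball: link potentials `W : Potential (ZdEdge d) SU(N)` with
continuous own-link terms, a support map `supp`, and per-link LOAD WITNESSES — oscillation `∑_{X ∋ e} osc X e ≤ a`, self-Lipschitz `∑_{X ∋ e} lip X e ≤ ℓ_s`,
and (the one load a spectral gap needs beyond the clustering rows) the COLUMN cross-Lipschitz load `∑_{e ∈ T} ∑_{X ∋ e} lip X y ≤ Λc` for every finite `T ∌ y`;
constants independent of `V`, `η` and the member; the member's OWN kernels appear; nothing about `β → ∞`, the continuum or Clay.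

THE STATEMENT (★★★ `kernelVariance_le_onBall`): `d ≥ 1`, `OneLinkKRModulus N b K` on `b ≥ 2(d−1)|β|`,
`c := 6(d−1)|β| K e^{a}(1 + 2√N ℓ_s) + √N Λc < 1` ⇒ for EVERY member, EVERY non-empty finite link volume `V`, EVERY boundary field `η` and every bounded
measurable `F`: `Var_{γ^W_V(·|η)}(F) ≤ (2(1 − c))⁻¹ ∑_{x ∈ V} ∫ (∫ (F(U) − F(σ))² γ^W_{x}(dσ|U)) γ^W_V(dU|η)` — the single-link heat-bath (Glauber) dynamics
of the member's finite volume with boundary condition has spectral gap `≥ 1 − c` (standard reading), UNIFORMLY IN `V`, `η` AND THE MEMBER.  The window is the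
cell's `ℤ^d` ball door window (`MassGapOfDoorKR.perturbedMassGapAt_of_oneLinkKRModulus`) with the column load `Λc` in place of the row load `Λ`.
★★ `su2_kernelVariance_le_onBall_quarter`: `SU(2)`, every `d`, quarter modulus: `c = (3/2)(d−1)β_W e^{a}(1 + 2√2 ℓ_s) + √2 Λc` (tree coupling `β_W/2`).
MECHANISM: the YangMills summit's engine `StrongPinningPoincare.HeatBath.variance_le_of_kr` on the product space of the volume, transported through
`glueWith` as in g12's Wilson file (`γ^W_V(·|η)` is the glued tilted product Haar measure; inside the volume the one-link tilt of the volume energy is the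
member's one-link law, by rb-p1's relative-energy locality `dependsOn_perturbedEnergy_sub` and `siteLaw_perturbedYM_eq_tilted_haar`), fed with rb-p1's
KR door `isKRContraction_perturbedYM_of_oneLinkKRModulus` (entries `K e^{a}(1 + 2√N ℓ_s)|β| n(e,y) + √N ℓ(e,y)`) and the symmetric count's column sums
`∑_{x ∈ T} n(x,y) ≤ 6(d−1)` (`HeatBathPoincareZd.sum_linkInfluence_col_le`).  0 sorry, 0 definitions.
References: L. Wu, Ann. Probab. 34 (2006) 1960; H. Föllmer, LNM 1362 (1988) Ch. I; H.-O. Georgii (2011) Def. 2.9, Rem. 1.24.  Everything here is proved. [folklore]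
-/

noncomputable section

open MeasureTheory Function Real Filter Finset ProbabilityTheory
open scoped ENNReal NNReal
open Literature.Probability.LatticeModels
open Literature.Probability.LatticeModels.DobrushinMetric
open Literature.MathematicalPhysics.QuantumLattice
open Literature.MathematicalPhysics.QuantumFieldTheory hiding ZdEdge
open Literature.MathematicalPhysics.QuantumFieldTheory.Balaban1983to89.StrongCouplingDobrushinWindow (OneLinkKRModulus)
open Summit.QuantumFields.YangMills.Theorems.StrongPinningPoincare
open Summit.Ventures.YMGap.RobustBall.HeatBathPoincareZd (sum_linkInfluence_col_le glueWith_update measurable_integral_sq_sub abs_integral_sq_sub_le)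

namespace Summit.Ventures.YMGap.RobustBall.HeatBathPoincareZdBall

variable {d N : ℕ}

/-- **Inside the volume, the one-link tilt of the member's volume energy is the member's one-link law**: for `x ∈ V`,
`Haar.tilted(E^W_V(U[x ↦ ·])) = γ^W_{x}(σ_x ∈ · | U)` — the energies of `V` and `{x}` differ by a term not reading the link `x`
(`dependsOn_perturbedEnergy_sub`), and tilting forgets additive constants. [folklore] -/
theorem tilted_update_eq_siteLaw (β' : ℝ) {W : Potential (ZdEdge d) (Matrix.specialUnitaryGroup (Fin N) ℂ)} (hW : W.IsAdapted)
    {supp : Finset (ZdEdge d) → Finset (Finset (ZdEdge d))} (hsupp : W.IsSupportedBy supp)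
    {V : Finset (ZdEdge d)} {x : ZdEdge d} (hx : x ∈ V) (U : LGConfig d (Matrix.specialUnitaryGroup (Fin N) ℂ)) :
    (haarProbability (Matrix.specialUnitaryGroup (Fin N) ℂ)).tilted
        (fun g => perturbedEnergy (fundamentalRep (Fin N)) β' W supp V (update U x g)) =
      siteLaw (perturbedYM (fundamentalRep (Fin N)) β' W supp) x U := by
  haveI : SecondCountableTopology (Matrix (Fin N) (Fin N) ℂ) := inferInstanceAs (SecondCountableTopology (Fin N → Fin N → ℂ))
  haveI : SecondCountableTopology (Matrix.specialUnitaryGroup (Fin N) ℂ) := Topology.IsEmbedding.subtypeVal.secondCountableTopology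
  rw [siteLaw_perturbedYM_eq_tilted_haar _ (continuous_fundamentalRep (Fin N)) β' (fun X => (hW X).2) supp x U]
  -- the difference `E_V − E_{x}` does not read the link `x`
  have hdep := dependsOn_perturbedEnergy_sub (fundamentalRep (Fin N)) β' hW hsupp (Finset.singleton_subset_iff.2 hx)
  set C : ℝ := perturbedEnergy (fundamentalRep (Fin N)) β' W supp V (update U x 1) -
    perturbedEnergy (fundamentalRep (Fin N)) β' W supp {x} (update U x 1) with hC
  have h1 : (fun g : Matrix.specialUnitaryGroup (Fin N) ℂ => perturbedEnergy (fundamentalRep (Fin N)) β' W supp V (update U x g)) =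
      fun g => C + perturbedEnergy (fundamentalRep (Fin N)) β' W supp {x} (update U x g) := by
    funext g
    have h := @hdep (update U x g) (update U x 1) (fun z hz => by
      have hz : z ≠ x := by simpa using hz
      rw [update_of_ne hz, update_of_ne hz])
    simp only at h
    rw [hC, ← h]
    ring
  rw [h1, tilted_const_add_eq]

/-- ★★★ **THE HEAT-BATH POINCARÉ INEQUALITY OF A FINITE VOLUME WITH BOUNDARY CONDITION, UNIFORMLY IN THE VOLUME, THE BOUNDARY FIELD AND THE MEMBER OF
THE `ℤ^d` BALL** (`SU(N)`, 't Hooft coupling `β`).  `OneLinkKRModulus N b K` on `b ≥ 2(d−1)|β|`; a member `W` (continuous own-link terms, support `supp`)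
with per-link loads `a` (oscillation), `ℓ_s` (self-Lipschitz) and COLUMN cross-Lipschitz load `Λc`; `c := 6(d−1)|β| K e^{a}(1 + 2√N ℓ_s) + √N Λc < 1`.
Then for every non-empty finite link volume `V`, every boundary field `η` and every bounded measurable `F`,
`Var_{γ^W_V(·|η)}(F) ≤ (2(1 − c))⁻¹ ∑_{x ∈ V} ∫ (∫ (F(U) − F(σ))² γ^W_{x}(dσ|U)) γ^W_V(dU|η)`. [folklore] -/
theorem kernelVariance_le_onBall (hd : 1 ≤ d) (hN : 1 ≤ N) {β b K a ℓs Λc c : ℝ} (hK : 0 ≤ K) (hℓs : 0 ≤ ℓs)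
    (hb : |β| * (2 * ((d : ℝ) - 1)) ≤ b) (hmod : OneLinkKRModulus N b K)
    {W : Potential (ZdEdge d) (Matrix.specialUnitaryGroup (Fin N) ℂ)} (hWc : ∀ X, Continuous (W X))
    (hWdep : ∀ X, DependsOn (W X) (↑X : Set (ZdEdge d)))
    {supp : Finset (ZdEdge d) → Finset (Finset (ZdEdge d))} (hsupp : W.IsSupportedBy supp)
    {osc : Finset (ZdEdge d) → ZdEdge d → ℝ} (hosc : ∀ X, Dobrushin.IsOscBound (W X) (osc X))
    (hosca : ∀ e, ∑ X ∈ (supp {e}).filter (fun X => e ∈ X), osc X e ≤ a)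
    {lip : Finset (ZdEdge d) → ZdEdge d → ℝ} (hlip : ∀ X, IsLipBound suFrobDist (W X) (lip X))
    (hlips : ∀ e, ∑ X ∈ (supp {e}).filter (fun X => e ∈ X), lip X e ≤ ℓs)
    (hcol : ∀ (y : ZdEdge d) (T : Finset (ZdEdge d)), y ∉ T → ∑ e ∈ T, ∑ X ∈ (supp {e}).filter (fun X => e ∈ X), lip X y ≤ Λc)
    (hc : 6 * ((d : ℝ) - 1) * |β| * (K * exp a * (1 + 2 * Real.sqrt N * ℓs)) + Real.sqrt N * Λc ≤ c) (hc1 : c < 1)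
    {V : Finset (ZdEdge d)} (hV : V.Nonempty) (η : LGConfig d (Matrix.specialUnitaryGroup (Fin N) ℂ))
    {F : LGConfig d (Matrix.specialUnitaryGroup (Fin N) ℂ) → ℝ} (hF : Measurable F) (hFb : ∃ M : ℝ, ∀ U, |F U| ≤ M) :
    ProbabilityTheory.variance F (perturbedYM (fundamentalRep (Fin N)) (N * β) W supp V η) ≤
      (2 * (1 - c))⁻¹ * ∑ x ∈ V, ∫ U, ∫ σ, (F U - F σ) ^ 2 ∂(perturbedYM (fundamentalRep (Fin N)) (N * β) W supp {x} U)
        ∂(perturbedYM (fundamentalRep (Fin N)) (N * β) W supp V η) := by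
  classical
  haveI : SecondCountableTopology (Matrix (Fin N) (Fin N) ℂ) := inferInstanceAs (SecondCountableTopology (Fin N → Fin N → ℂ))
  haveI : SecondCountableTopology (Matrix.specialUnitaryGroup (Fin N) ℂ) := Topology.IsEmbedding.subtypeVal.secondCountableTopology
  haveI : Nonempty (Fin N) := ⟨⟨0, hN⟩⟩
  haveI : Nonempty ↥V := hV.coe_sort
  obtain ⟨M, hM⟩ := hFb
  have hρc := continuous_fundamentalRep (Fin N)
  have hW : W.IsAdapted := fun X => ⟨hWdep X, (hWc X).measurable⟩
  have hWb : ∀ X, ∃ C, ∀ U, |W X U| ≤ C := fun X => exists_bound_of_continuous (hWc X)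
  set γ := perturbedYM (d := d) (fundamentalRep (Fin N)) (N * β) W supp with hγdef
  have hγ : IsSpecification γ := isSpecification_perturbedYM _ hρc _ hW hWb hsupp
  -- the product space over the volume and the gluing map
  set lam := haarProbability (Matrix.specialUnitaryGroup (Fin N) ℂ) with hlam
  set glue : (↥V → Matrix.specialUnitaryGroup (Fin N) ℂ) → LGConfig d (Matrix.specialUnitaryGroup (Fin N) ℂ) :=
    fun ζ => glueWith V ζ η with hglue
  have hgm : Measurable glue := measurable_glueWith V η
  set E : LGConfig d (Matrix.specialUnitaryGroup (Fin N) ℂ) → ℝ := perturbedEnergy (fundamentalRep (Fin N)) (N * β) W supp V with hE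
  have hEc : Continuous E := continuous_perturbedEnergy _ hρc _ hWc supp V
  obtain ⟨B, hB⟩ := exists_bound_of_continuous hEc
  have hVm : Measurable (E ∘ glue) := hEc.measurable.comp hgm
  have hVb : ∀ x, |(E ∘ glue) x| ≤ B := fun x => hB _
  -- the kernel is the glued tilted product measure
  have hker : γ V η = ((Measure.pi fun _ : ↥V => lam).tilted (E ∘ glue)).map glue := by
    rw [map_tilted_comp _ hgm hEc.measurable]
    rfl
  -- the Frobenius distance on `SU(N)`
  have hdc : Continuous fun p : Matrix.specialUnitaryGroup (Fin N) ℂ × Matrix.specialUnitaryGroup (Fin N) ℂ => suFrobDist p.1 p.2 :=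
    Lattice.continuous_frobNorm.comp ((continuous_subtype_val.comp continuous_fst).sub (continuous_subtype_val.comp continuous_snd))
  have hd0 : ∀ e : Matrix.specialUnitaryGroup (Fin N) ℂ, suFrobDist e e = 0 := suFrobDist_self
  have hdsep : ∀ e e' : Matrix.specialUnitaryGroup (Fin N) ℂ, suFrobDist e e' = 0 → e = e' := fun e e' h =>
    Subtype.ext (sub_eq_zero.1 (Lattice.eq_zero_of_frobNorm_eq_zero h))
  have hdtri : ∀ a' b' c' : Matrix.specialUnitaryGroup (Fin N) ℂ, suFrobDist a' c' ≤ suFrobDist a' b' + suFrobDist b' c' :=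
    fun a' b' c' => frobNorm_sub_le _ _ _
  -- rb-p1's door and the interaction matrix (its entries), column sums
  have hdoor := isKRContraction_perturbedYM_of_oneLinkKRModulus hd hN hK hℓs hb hmod hW (supp := supp) hosc hosca hlip hlips
  set Cf : ZdEdge d → ZdEdge d → ℝ := fun e y => K * exp a * (1 + 2 * Real.sqrt N * ℓs) * |β| * linkInfluence e y +
    Real.sqrt N * ∑ X ∈ (supp {e}).filter (fun X => e ∈ X), lip X y with hCf
  set cm : ↥V → ↥V → ℝ := fun i j => Cf i.1 j.1 with hcm
  have hκ₀ : 0 < 1 - c := by linarith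
  have hΛc : 0 ≤ Λc := by
    obtain ⟨y₀⟩ : Nonempty (ZdEdge d) := ⟨((fun _ => 0), ⟨0, hd⟩)⟩
    simpa using hcol y₀ ∅ (Finset.notMem_empty _)
  have hdd : (0 : ℝ) ≤ (d : ℝ) - 1 := by
    have : (1 : ℝ) ≤ d := by exact_mod_cast hd
    linarith
  have hA0 : 0 ≤ K * exp a * (1 + 2 * Real.sqrt N * ℓs) * |β| := by positivity
  have hd1 : ((6 * (d - 1) : ℕ) : ℝ) = 6 * ((d : ℝ) - 1) := by push_cast [Nat.cast_sub hd]; ring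
  have hcsum : ∀ j, ∑ i ∈ Finset.univ.erase j, cm i j ≤ 1 - (1 - c) := fun j => by
    simp only [hcm, hCf]
    rw [sub_sub_cancel, Finset.sum_add_distrib, ← Finset.mul_sum, ← Finset.mul_sum]
    have h1 : ∀ φ : ZdEdge d → ℝ, ∑ i ∈ Finset.univ.erase j, φ i.1 = ∑ x ∈ V.erase j.1, φ x := fun φ => by
      rw [Finset.sum_erase_eq_sub (Finset.mem_univ j), Finset.sum_erase_eq_sub j.2, Finset.sum_coe_sort V φ]
    rw [h1 (fun x => (linkInfluence x j.1 : ℝ)), h1 (fun x => ∑ X ∈ (supp {x}).filter (fun X => x ∈ X), lip X j.1)]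
    have h2 : ∑ x ∈ V.erase j.1, (linkInfluence x j.1 : ℝ) ≤ 6 * ((d : ℝ) - 1) := by
      rw [← hd1]; exact_mod_cast sum_linkInfluence_col_le j.1 (Finset.notMem_erase j.1 V)
    have h3 := hcol j.1 (V.erase j.1) (Finset.notMem_erase j.1 V)
    calc K * exp a * (1 + 2 * Real.sqrt N * ℓs) * |β| * ∑ x ∈ V.erase j.1, (linkInfluence x j.1 : ℝ) +
          Real.sqrt N * ∑ x ∈ V.erase j.1, ∑ X ∈ (supp {x}).filter (fun X => x ∈ X), lip X j.1
        ≤ K * exp a * (1 + 2 * Real.sqrt N * ℓs) * |β| * (6 * ((d : ℝ) - 1)) + Real.sqrt N * Λc :=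
          add_le_add (mul_le_mul_of_nonneg_left h2 hA0) (mul_le_mul_of_nonneg_left h3 (Real.sqrt_nonneg _))
      _ = 6 * ((d : ℝ) - 1) * |β| * (K * exp a * (1 + 2 * Real.sqrt N * ℓs)) + Real.sqrt N * Λc := by ring
      _ ≤ c := hc
  -- one-link updates through the gluing
  have hup : ∀ (x : ↥V → Matrix.specialUnitaryGroup (Fin N) ℂ) (i : ↥V) (e : Matrix.specialUnitaryGroup (Fin N) ℂ),
      glue (update x i e) = update (glue x) i.1 e := fun x i e => glueWith_update V η x i e
  have htilt : ∀ (x : ↥V → Matrix.specialUnitaryGroup (Fin N) ℂ) (i : ↥V),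
      lam.tilted (fun e => (E ∘ glue) (update x i e)) = siteLaw γ i.1 (glue x) := fun x i => by
    have h1 : (fun e => (E ∘ glue) (update x i e)) =
        fun g => perturbedEnergy (fundamentalRep (Fin N)) (N * β) W supp V (update (glue x) i.1 g) := by
      funext e; simp only [Function.comp, hE, hup]
    rw [h1, tilted_update_eq_siteLaw _ hW hsupp i.2]
  -- the one-site Kantorovich–Rubinstein condition from rb-p1's door
  have hKR : ∀ (i j : ↥V), i ≠ j → ∀ (x : ↥V → Matrix.specialUnitaryGroup (Fin N) ℂ)
      (a' : Matrix.specialUnitaryGroup (Fin N) ℂ) (ψ : Matrix.specialUnitaryGroup (Fin N) ℂ → ℝ) (Lψ Mψ : ℝ), Measurable ψ →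
      (∀ e, |ψ e| ≤ Mψ) → 0 ≤ Lψ → (∀ e e', |ψ e - ψ e'| ≤ Lψ * suFrobDist e e') →
      |∫ e, ψ e ∂(lam.tilted fun e => (E ∘ glue) (update x i e)) -
        ∫ e, ψ e ∂(lam.tilted fun e => (E ∘ glue) (update (update x j a') i e))| ≤ Lψ * cm i j * suFrobDist (x j) a' := by
    intro i j hij x a' ψ Lψ Mψ hψm hψb hL0 hψL
    rw [htilt x i, htilt (update x j a') i]
    have hja : glue (update x j a') j.1 = a' := by rw [hup, update_self]
    have hjx : glue x j.1 = x j := by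
      show glueWith V x η j.1 = x j
      rw [glueWith_apply_mem _ _ _ j.2]
    have hoff : ∀ z, z ≠ j.1 → glue x z = glue (update x j a') z := fun z hz => by rw [hup, update_of_ne hz]
    by_cases hmem : j.1 ∈ perturbedNbr supp i.1
    · have key := hdoor.contract i.1 j.1 hmem (glue x) (glue (update x j a')) hoff ψ Lψ hψm ⟨Mψ, hψb⟩ hL0 hψL
      rw [hja, hjx] at key
      calc _ ≤ Cf i.1 j.1 * Lψ * suFrobDist (x j) a' := key
        _ = Lψ * cm i j * suFrobDist (x j) a' := by simp only [hcm]; ring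
    · have hsame : siteLaw γ i.1 (glue x) = siteLaw γ i.1 (glue (update x j a')) :=
        hdoor.siteLaw_congr i.1 _ _ fun z hz => hoff z (fun h => hmem (h ▸ hz))
      rw [hsame, sub_self, abs_zero]
      exact mul_nonneg (mul_nonneg hL0 (hdoor.nonneg _ _)) (suFrobDist_nonneg _ _)
  -- the abstract theorem on the product space
  have key := HeatBath.variance_le_of_kr (ι := ↥V) lam hVm hVb suFrobDist hdc hd0 suFrobDist_nonneg suFrobDist_comm hdtri hdsep
    suFrobDist_le cm hκ₀ (by linarith [le_trans (add_nonneg (by positivity) (mul_nonneg (Real.sqrt_nonneg (N : ℝ)) hΛc)) hc])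
    hcsum hKR (hF.comp hgm) (fun x => hM (glue x))
  -- back to the volume: left-hand side
  rw [hker, ProbabilityTheory.variance_map hF.aemeasurable hgm.aemeasurable]
  refine key.trans (le_of_eq ?_)
  congr 1
  rw [← Finset.sum_coe_sort V]
  refine Finset.sum_congr rfl fun i _ => ?_
  -- right-hand side, link by link
  have hh : ∀ x : ↥V → Matrix.specialUnitaryGroup (Fin N) ℂ,
      ∫ e, ((F ∘ glue) x - (F ∘ glue) (update x i e)) ^ 2 ∂(lam.tilted fun e => (E ∘ glue) (update x i e)) =
        ∫ σ, (F (glue x) - F σ) ^ 2 ∂(γ {i.1} (glue x)) := fun x => by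
    rw [htilt x i]
    have h2 := siteAvg_eq_integral_siteLaw hγ i.1 (f := fun σ => (F (glue x) - F σ) ^ 2) (measurable_const.sub hF |>.pow_const 2) (glue x)
    unfold siteAvg at h2
    beta_reduce at h2
    rw [h2]
    simp only [Function.comp, hup]
  simp_rw [hh]
  exact (integral_map hgm.aemeasurable (measurable_integral_sq_sub hγ i.1 hF hM).aestronglyMeasurable).symm

/-- ★★ **`SU(2)`, EVERY DIMENSION, QUARTER MODULUS — the heat-bath Poincaré inequality of every finite volume of the `ℤ^d` ball member with every boundary
field** (tree coupling `β_W/2`, 't Hooft `β_W/4`; `su2_oneLinkKRModulus_of_le_one` on `(d−1)β_W/2 ≤ 1`): with per-link loads `(a, ℓ_s)` and column load `Λc`,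
if `c := (3/2)(d−1)β_W e^{a}(1 + 2√2 ℓ_s) + √2 Λc < 1` then `Var_{γ^W_V(·|η)}(F) ≤ (2(1 − c))⁻¹ ∑_{x∈V} ∫∫ (F(U) − F(σ))² γ^W_{x}(dσ|U) γ^W_V(dU|η)`
— the window of the cell's `ℤ^d` quarter-door row (`MassGapOfDoorKR.su2_perturbedMassGapAt_quarter`) with the column load in place of the row load. [folklore] -/
theorem su2_kernelVariance_le_onBall_quarter (hd : 1 ≤ d) {βW a ℓs Λc c : ℝ} (h0 : 0 ≤ βW) (hβ : ((d : ℝ) - 1) * βW / 2 ≤ 1)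
    (hℓs : 0 ≤ ℓs) {W : Potential (ZdEdge d) (Matrix.specialUnitaryGroup (Fin 2) ℂ)} (hWc : ∀ X, Continuous (W X))
    (hWdep : ∀ X, DependsOn (W X) (↑X : Set (ZdEdge d)))
    {supp : Finset (ZdEdge d) → Finset (Finset (ZdEdge d))} (hsupp : W.IsSupportedBy supp)
    {osc : Finset (ZdEdge d) → ZdEdge d → ℝ} (hosc : ∀ X, Dobrushin.IsOscBound (W X) (osc X))
    (hosca : ∀ e, ∑ X ∈ (supp {e}).filter (fun X => e ∈ X), osc X e ≤ a)
    {lip : Finset (ZdEdge d) → ZdEdge d → ℝ} (hlip : ∀ X, IsLipBound suFrobDist (W X) (lip X))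
    (hlips : ∀ e, ∑ X ∈ (supp {e}).filter (fun X => e ∈ X), lip X e ≤ ℓs)
    (hcol : ∀ (y : ZdEdge d) (T : Finset (ZdEdge d)), y ∉ T → ∑ e ∈ T, ∑ X ∈ (supp {e}).filter (fun X => e ∈ X), lip X y ≤ Λc)
    (hc : 3 / 2 * ((d : ℝ) - 1) * βW * (exp a * (1 + 2 * Real.sqrt 2 * ℓs)) + Real.sqrt 2 * Λc ≤ c) (hc1 : c < 1)
    {V : Finset (ZdEdge d)} (hV : V.Nonempty) (η : LGConfig d (Matrix.specialUnitaryGroup (Fin 2) ℂ))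
    {F : LGConfig d (Matrix.specialUnitaryGroup (Fin 2) ℂ) → ℝ} (hF : Measurable F) (hFb : ∃ M : ℝ, ∀ U, |F U| ≤ M) :
    ProbabilityTheory.variance F (perturbedYM (fundamentalRep (Fin 2)) (2 * (βW / 4)) W supp V η) ≤
      (2 * (1 - c))⁻¹ * ∑ x ∈ V, ∫ U, ∫ σ, (F U - F σ) ^ 2 ∂(perturbedYM (fundamentalRep (Fin 2)) (2 * (βW / 4)) W supp {x} U)
        ∂(perturbedYM (fundamentalRep (Fin 2)) (2 * (βW / 4)) W supp V η) := by
  have hdd : (0 : ℝ) ≤ (d : ℝ) - 1 := by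
    have : (1 : ℝ) ≤ d := by exact_mod_cast hd
    linarith
  have habs : |βW / 4| = βW / 4 := abs_of_nonneg (by positivity)
  have key := kernelVariance_le_onBall (N := 2) hd (by norm_num) (β := βW / 4) zero_le_one hℓs (b := ((d : ℝ) - 1) * βW / 2)
    (by rw [habs]; nlinarith) (SlabAreaLawDimensions.su2_oneLinkKRModulus_of_le_one hβ) hWc hWdep hsupp hosc hosca hlip hlips hcol
    (c := c) (by rw [habs]; push_cast; nlinarith [hc]) hc1 hV η hF hFb
  push_cast at key
  exact key

end Summit.Ventures.YMGap.RobustBall.HeatBathPoincareZdBall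

end
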